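import Literature.NumberTheory.Automorphic.IntegralCosetFibrationGL
import Mathlib.LinearAlgebra.Quotient.Pi
import Mathlib.LinearAlgebra.Quotient.Card
import Mathlib.LinearAlgebra.Isomorphisms
import Mathlib.RingTheory.DiscreteValuationRing.Basic
import HarnessLib

/-!
# Truncated lattice indices `[𝒪ⁿ : g 𝒪ⁿ + ϖ^k 𝒪ⁿ]` and the elementary-divisor type of a block
# `[[ϖ^ν, y], [0, ϖ^m]]`

Topic `NumberTheory/Automorphic`; theorems and definitions with bodies only (no named fact).
Setting: a field `F` with a `ValuativeRel` whose valuation ring `𝒪 = 𝒪[F]` is a discrete valuation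
ring with finite residue field `𝓀`, `q = #𝓀`, a uniformizing element `ϖ`, `K_N = GL_N(𝒪)`.

For an `N × N` matrix `G` over `𝒪` and `k ≥ 0` let
`truncColSpan ϖ k G = G 𝒪^N + ϖ^k 𝒪^N ⊆ 𝒪^N` and `truncIndex ϖ k G = #(𝒪^N / (G 𝒪^N + ϖ^k 𝒪^N))`.
These indices are the invariants `|A / ϖ^k A|` of the finite `𝒪`-module `A = 𝒪^N / G 𝒪^N`
(Macdonald, *Symmetric functions and Hall polynomials* (1995), Ch. II, §1: a finite `𝒪`-module
of type `λ` has `|A/ϖ^k A| = q^{∑ min(λ_i, k)}`, (1.4)–(1.6)); they are what this file uses in place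
of elementary divisors.  Everything is proved:

* invariance `truncIndex (u G u') = truncIndex G` for `u, u' ∈ GL_N(𝒪)`
  (`truncIndex_units_mul_mul_units`), the value `q^{∑ min(a_i, k)}` on `diag(ϖ^a)`
  (`truncIndex_diagonal`, through `#(𝒪/ϖ^j) = q^j`, `natCard_quotient_span_pow`), and hence
  (`truncIndex_eq_of_mem_doubleCoset`) **`truncIndex_k = q^{∑ min(a_i,k)}` for every integral
  `g ∈ K_N ϖ^a K_N`** — the numerical shadow of the Cartan type;
* for the block `Y = [[ϖ^ν, y], [0, ϖ^m]]` (`blockSuccMatrix` of `IntegralCosetFibrationGL`) the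
  **index formula** `truncIndex_k(Y) · #(𝒪 / J_k) = q^{∑ min(ν_i,k) + k}` (`truncIndex_block_mul`),
  where `J_k = {t ∈ 𝒪 : t · (y, ϖ^m) ∈ ⊕ (ϖ^{ν_i} 𝒪 + ϖ^k 𝒪) ⊕ ϖ^k 𝒪}` (`blockIdeal`) is the
  annihilator of the last column in `𝒪^{n+1} / (⊕ ϖ^{min(ν_i,k)} 𝒪 ⊕ ϖ^k 𝒪)` (second and third
  isomorphism theorems);
* `J_k = ϖ^{D_k} 𝒪` with `D_0 = 0`, `D_k ≤ D_{k+1} ≤ D_k + 1`, `D_k ≤ k` (`blockExp`,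
  `blockExp_zero`, `blockExp_le_succ`, `blockExp_succ_le`, `blockExp_le`) —
  `J_{k+1} ⊆ J_k`, `ϖ J_k ⊆ J_{k+1}`, `ϖ^k ∈ J_k`;
* **the type equations** (`sum_min_add_blockExp_eq`): if `[[ϖ^ν, y], [0, ϖ^m]] ∈ K ϖ^Λ K` in
  `GL_{n+1}(F)` then `∑_i min(Λ_i, k) + D_k = ∑_i min(ν_i, k) + k` for all `k`, and
  (`pow_dvd_of_pow_blockExp_mem`) `ϖ^{ν_i - min(ν_i, D_{ν_i})} ∣ y_i` — the constraints on the
  extension class `y` of a lattice `M ⊆ 𝒪^{n+1}` with `M ∩ 𝒪ⁿ` of type `ν` and `𝒪^{n+1}/M` of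
  type `Λ` (Macdonald (1995), Ch. II, (4.2)–(4.3): `λ/ν` is a horizontal strip; here in the form
  needed to *bound* the number of such classes, `SphericalXiEstimateGL`).

## References

* I. G. Macdonald, *Symmetric functions and Hall polynomials*, 2nd ed. (1995), Ch. II, §1 and §4;
  Ch. V, §2 [Macdonald1995].
-/

noncomputable section

open scoped MatrixGroups
open ValuativeRel Matrix Finset

namespace Literature.NumberTheory.Automorphic

variable {F : Type*} [Field F] [ValuativeRel F]

/-! ### Principal-power sublattices `⊕ c_i 𝒪` and truncated column spans -/

section Trunc

variable {N : ℕ}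

/-- The lattice `⊕_i c_i 𝒪 ⊆ 𝒪^N` of vectors with `i`-th coordinate divisible by `c_i`. [folklore] -/
def piSpan (c : Fin N → 𝒪[F]) : Submodule 𝒪[F] (Fin N → 𝒪[F]) :=
  Submodule.pi Set.univ fun i => Ideal.span {c i}

/-- Membership in `⊕ c_i 𝒪`: coordinatewise divisibility. [folklore] -/
theorem mem_piSpan_iff {c : Fin N → 𝒪[F]} {v : Fin N → 𝒪[F]} :
    v ∈ piSpan c ↔ ∀ i, c i ∣ v i := by
  simp only [piSpan, Submodule.mem_pi, Set.mem_univ, forall_const, Ideal.mem_span_singleton]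

/-- Membership in `⊕ c_i 𝒪`: `v = (c_i p_i)_i`. [folklore] -/
theorem mem_piSpan_iff_exists {c : Fin N → 𝒪[F]} {v : Fin N → 𝒪[F]} :
    v ∈ piSpan c ↔ ∃ p : Fin N → 𝒪[F], v = fun i => c i * p i := by
  rw [mem_piSpan_iff]
  refine ⟨fun h => ?_, ?_⟩
  · choose p hp using h
    exact ⟨p, funext hp⟩
  · rintro ⟨p, rfl⟩ i
    exact Dvd.intro _ rfl

/-- **The truncated column lattice** `G 𝒪^N + ϖ^k 𝒪^N ⊆ 𝒪^N` of a matrix `G` over `𝒪`. [folklore] -/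
def truncColSpan (ϖ : 𝒪[F]) (k : ℕ) (G : Matrix (Fin N) (Fin N) 𝒪[F]) :
    Submodule 𝒪[F] (Fin N → 𝒪[F]) :=
  LinearMap.range G.mulVecLin ⊔ piSpan fun _ => ϖ ^ k

/-- **The truncated index** `[𝒪^N : G 𝒪^N + ϖ^k 𝒪^N] = |A / ϖ^k A|`, `A = 𝒪^N / G 𝒪^N`
(Macdonald (1995), Ch. II, §1). [folklore] -/
def truncIndex (ϖ : 𝒪[F]) (k : ℕ) (G : Matrix (Fin N) (Fin N) 𝒪[F]) : ℕ :=
  Nat.card ((Fin N → 𝒪[F]) ⧸ truncColSpan ϖ k G)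

/-- Membership in the truncated column lattice. [folklore] -/
theorem mem_truncColSpan_iff {ϖ : 𝒪[F]} {k : ℕ} {G : Matrix (Fin N) (Fin N) 𝒪[F]}
    {v : Fin N → 𝒪[F]} :
    v ∈ truncColSpan ϖ k G ↔ ∃ z p : Fin N → 𝒪[F], v = G *ᵥ z + fun i => ϖ ^ k * p i := by
  rw [truncColSpan, Submodule.mem_sup]
  constructor
  · rintro ⟨a, ha, b, hb, rfl⟩
    obtain ⟨z, rfl⟩ := LinearMap.mem_range.1 ha
    obtain ⟨p, rfl⟩ := mem_piSpan_iff_exists.1 hb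
    exact ⟨z, p, rfl⟩
  · rintro ⟨z, p, rfl⟩
    exact ⟨G *ᵥ z, LinearMap.mem_range.2 ⟨z, rfl⟩, _, mem_piSpan_iff_exists.2 ⟨p, rfl⟩, rfl⟩

/-- The linear automorphism `v ↦ u v` of `R^N` attached to `u ∈ GL_N(R)`. [folklore] -/
def glMulVecEquiv {R : Type*} [CommRing R] (u : GL (Fin N) R) : (Fin N → R) ≃ₗ[R] (Fin N → R) where
  toFun v := (u : Matrix (Fin N) (Fin N) R) *ᵥ v
  invFun v := ((u⁻¹ : GL (Fin N) R) : Matrix (Fin N) (Fin N) R) *ᵥ v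
  map_add' := Matrix.mulVec_add _
  map_smul' c v := Matrix.mulVec_smul _ c v
  left_inv v := by
    change ((u⁻¹ : GL (Fin N) R) : Matrix (Fin N) (Fin N) R) *ᵥ ((u : Matrix (Fin N) (Fin N) R) *ᵥ v) = v
    rw [Matrix.mulVec_mulVec, ← Units.val_mul, inv_mul_cancel, Units.val_one, Matrix.one_mulVec]
  right_inv v := by
    change (u : Matrix (Fin N) (Fin N) R) *ᵥ (((u⁻¹ : GL (Fin N) R) : Matrix (Fin N) (Fin N) R) *ᵥ v) = v
    rw [Matrix.mulVec_mulVec, ← Units.val_mul, mul_inv_cancel, Units.val_one, Matrix.one_mulVec]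

/-- Unfolding `glMulVecEquiv`. [folklore] -/
@[simp]
theorem glMulVecEquiv_apply {R : Type*} [CommRing R] (u : GL (Fin N) R) (v : Fin N → R) :
    glMulVecEquiv u v = (u : Matrix (Fin N) (Fin N) R) *ᵥ v := rfl

/-- `u (⊕ c 𝒪) ⊆ ⊕ c 𝒪` for an integral matrix `u` and a constant `c`. [folklore] -/
theorem mulVec_mem_piSpan_const (u : Matrix (Fin N) (Fin N) 𝒪[F]) (c : 𝒪[F]) {v : Fin N → 𝒪[F]}
    (hv : v ∈ piSpan fun _ : Fin N => c) : u *ᵥ v ∈ piSpan fun _ : Fin N => c := by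
  obtain ⟨p, rfl⟩ := mem_piSpan_iff_exists.1 hv
  refine mem_piSpan_iff_exists.2 ⟨u *ᵥ p, ?_⟩
  rw [show (fun i => c * p i) = c • p from rfl, Matrix.mulVec_smul]
  rfl

/-- `u (⊕ c 𝒪) = ⊕ c 𝒪` for `u ∈ GL_N(𝒪)`. [folklore] -/
theorem map_piSpan_const (u : GL (Fin N) 𝒪[F]) (c : 𝒪[F]) :
    (piSpan fun _ : Fin N => c).map (glMulVecEquiv u : (Fin N → 𝒪[F]) →ₗ[𝒪[F]] Fin N → 𝒪[F]) =
      piSpan fun _ => c := by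
  refine le_antisymm ?_ fun v hv => ?_
  · rintro _ ⟨v, hv, rfl⟩
    exact mulVec_mem_piSpan_const _ c hv
  · refine ⟨(glMulVecEquiv u).symm v, mulVec_mem_piSpan_const _ c hv, ?_⟩
    exact (glMulVecEquiv u).apply_symm_apply v

/-- **Right invariance**: `G u 𝒪^N = G 𝒪^N` for `u ∈ GL_N(𝒪)`. [folklore] -/
theorem truncColSpan_mul_units (ϖ : 𝒪[F]) (k : ℕ) (G : Matrix (Fin N) (Fin N) 𝒪[F])
    (u : GL (Fin N) 𝒪[F]) :
    truncColSpan ϖ k (G * (u : Matrix (Fin N) (Fin N) 𝒪[F])) = truncColSpan ϖ k G := by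
  rw [truncColSpan, truncColSpan, Matrix.mulVecLin_mul, LinearMap.range_comp_of_range_eq_top]
  exact LinearMap.range_eq_top.2 (glMulVecEquiv u).surjective

/-- **Left covariance**: `u G 𝒪^N + ϖ^k 𝒪^N = u (G 𝒪^N + ϖ^k 𝒪^N)` for `u ∈ GL_N(𝒪)`. [folklore] -/
theorem truncColSpan_units_mul (ϖ : 𝒪[F]) (k : ℕ) (G : Matrix (Fin N) (Fin N) 𝒪[F])
    (u : GL (Fin N) 𝒪[F]) :
    truncColSpan ϖ k ((u : Matrix (Fin N) (Fin N) 𝒪[F]) * G) =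
      (truncColSpan ϖ k G).map (glMulVecEquiv u : (Fin N → 𝒪[F]) →ₗ[𝒪[F]] Fin N → 𝒪[F]) := by
  rw [truncColSpan, truncColSpan, Submodule.map_sup, map_piSpan_const, ← LinearMap.range_comp,
    Matrix.mulVecLin_mul]
  rfl

/-- **Invariance of the truncated index under `GL_N(𝒪) × GL_N(𝒪)`.** [folklore] -/
theorem truncIndex_units_mul_mul_units (ϖ : 𝒪[F]) (k : ℕ) (G : Matrix (Fin N) (Fin N) 𝒪[F])
    (u u' : GL (Fin N) 𝒪[F]) :
    truncIndex ϖ k ((u : Matrix (Fin N) (Fin N) 𝒪[F]) * G * (u' : Matrix (Fin N) (Fin N) 𝒪[F])) =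
      truncIndex ϖ k G := by
  rw [truncIndex, truncIndex, truncColSpan_mul_units, truncColSpan_units_mul]
  exact Nat.card_congr (Submodule.Quotient.equiv _ _ (glMulVecEquiv u) rfl).toEquiv.symm

/-! ### `#(𝒪 / ϖ^j 𝒪) = q^j` and the index of `diag(ϖ^a)` -/

/-- `ϖ^a 𝒪 + ϖ^b 𝒪 = ϖ^{min(a,b)} 𝒪`. [folklore] -/
theorem span_pow_sup_span_pow (ϖ : 𝒪[F]) (a b : ℕ) :
    Ideal.span {ϖ ^ a} ⊔ Ideal.span {ϖ ^ b} = Ideal.span ({ϖ ^ min a b} : Set 𝒪[F]) := by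
  rcases le_total a b with h | h
  · rw [min_eq_left h, sup_eq_left]
    exact Ideal.span_singleton_le_span_singleton.2 (pow_dvd_pow ϖ h)
  · rw [min_eq_right h, sup_eq_right]
    exact Ideal.span_singleton_le_span_singleton.2 (pow_dvd_pow ϖ h)

/-- The truncated column lattice of `diag(c)` is `⊕ (c_i 𝒪 + ϖ^k 𝒪)`: if
`c_i 𝒪 + ϖ^k 𝒪 = d_i 𝒪` for all `i` then it is `⊕ d_i 𝒪`. [folklore] -/
theorem truncColSpan_diagonal_of_sup_eq (ϖ : 𝒪[F]) (k : ℕ) {c d : Fin N → 𝒪[F]}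
    (h : ∀ i, Ideal.span {c i} ⊔ Ideal.span {ϖ ^ k} = Ideal.span ({d i} : Set 𝒪[F])) :
    truncColSpan ϖ k (Matrix.diagonal c) = piSpan d := by
  ext v
  rw [mem_truncColSpan_iff, mem_piSpan_iff]
  have hmem : ∀ i (x : 𝒪[F]), d i ∣ x ↔ ∃ z p : 𝒪[F], x = c i * z + ϖ ^ k * p := by
    intro i x
    rw [← Ideal.mem_span_singleton, ← h i, Submodule.mem_sup]
    constructor
    · rintro ⟨a, ha, b, hb, rfl⟩
      obtain ⟨z, rfl⟩ := Ideal.mem_span_singleton'.1 ha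
      obtain ⟨p, rfl⟩ := Ideal.mem_span_singleton'.1 hb
      exact ⟨z, p, by rw [mul_comm z, mul_comm p]⟩
    · rintro ⟨z, p, rfl⟩
      exact ⟨_, Ideal.mem_span_singleton'.2 ⟨z, mul_comm _ _⟩, _,
        Ideal.mem_span_singleton'.2 ⟨p, mul_comm _ _⟩, rfl⟩
  constructor
  · rintro ⟨z, p, rfl⟩ i
    rw [Pi.add_apply, Matrix.mulVec_diagonal]
    exact (hmem i _).2 ⟨z i, p i, rfl⟩
  · intro hv
    have h' : ∀ i, ∃ z p : 𝒪[F], v i = c i * z + ϖ ^ k * p := fun i => (hmem i _).1 (hv i)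
    choose z p hzp using h'
    refine ⟨z, p, funext fun i => ?_⟩
    rw [Pi.add_apply, Matrix.mulVec_diagonal, hzp]

/-- The truncated column lattice of `diag(ϖ^a)` is `⊕ ϖ^{min(a_i,k)} 𝒪`. [folklore] -/
theorem truncColSpan_diagonal_pow (ϖ : 𝒪[F]) (k : ℕ) (a : Fin N → ℕ) :
    truncColSpan ϖ k (Matrix.diagonal fun i => ϖ ^ a i) = piSpan fun i => ϖ ^ min (a i) k :=
  truncColSpan_diagonal_of_sup_eq ϖ k fun i => span_pow_sup_span_pow ϖ (a i) k

/-- `#(𝒪^N / ⊕ c_i 𝒪) = ∏ #(𝒪 / c_i 𝒪)`. [folklore] -/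
theorem natCard_quotient_piSpan (c : Fin N → 𝒪[F]) :
    Nat.card ((Fin N → 𝒪[F]) ⧸ piSpan c) = ∏ i, Nat.card (𝒪[F] ⧸ Ideal.span {c i}) := by
  classical
  rw [piSpan, Nat.card_congr (Submodule.quotientPi fun i : Fin N =>
    (Ideal.span {c i} : Submodule 𝒪[F] 𝒪[F])).toEquiv, Nat.card_pi]

section Card

variable {ϖ : F} (hϖ : IsUniformizingElement ϖ)
include hϖ

/-- `ϖ 𝒪 = 𝔪`, for `ϖ` as an element of `𝒪`. [folklore] -/
theorem IsUniformizingElement.span_coe_eq_maximalIdeal :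
    Ideal.span ({(⟨ϖ, hϖ.mem⟩ : 𝒪[F])} : Set 𝒪[F]) = IsLocalRing.maximalIdeal 𝒪[F] :=
  hϖ.span_eq.symm

/-- `ϖ ≠ 0` in `𝒪`. [folklore] -/
theorem IsUniformizingElement.coe_ne_zero : (⟨ϖ, hϖ.mem⟩ : 𝒪[F]) ≠ 0 := fun h =>
  hϖ.ne_zero (congrArg Subtype.val h)

/-- `#(𝒪 / ϖ 𝒪) = q`. [folklore] -/
theorem natCard_quotient_span_uniformizer :
    Nat.card (𝒪[F] ⧸ Ideal.span ({(⟨ϖ, hϖ.mem⟩ : 𝒪[F])} : Set 𝒪[F])) = Nat.card 𝓀[F] := by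
  rw [hϖ.span_coe_eq_maximalIdeal]
  rfl

/-- **`#(𝒪 / ϖ^j 𝒪) = q^j`.** Induction on `j`: `ϖ^j 𝒪 / ϖ^{j+1} 𝒪 ≅ 𝒪 / ϖ 𝒪 = 𝓀` through
`t ↦ ϖ^j t` (Macdonald (1995), Ch. II, (1.4)). [folklore] -/
theorem natCard_quotient_span_pow (j : ℕ) :
    Nat.card (𝒪[F] ⧸ Ideal.span ({(⟨ϖ, hϖ.mem⟩ : 𝒪[F]) ^ j} : Set 𝒪[F])) = Nat.card 𝓀[F] ^ j := by
  set π : 𝒪[F] := ⟨ϖ, hϖ.mem⟩ with hπ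
  have hπ0 : π ≠ 0 := hϖ.coe_ne_zero
  induction j with
  | zero =>
    rw [pow_zero, Ideal.span_singleton_one, pow_zero]
    haveI : Subsingleton (𝒪[F] ⧸ (⊤ : Submodule 𝒪[F] 𝒪[F])) :=
      Submodule.Quotient.subsingleton_iff.2 rfl
    exact Nat.card_of_subsingleton (0 : 𝒪[F] ⧸ (⊤ : Submodule 𝒪[F] 𝒪[F]))
  | succ j ih =>
    -- `T = ϖ^{j+1} 𝒪 ≤ S = ϖ^j 𝒪`
    set S : Submodule 𝒪[F] 𝒪[F] := Ideal.span {π ^ j} with hS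
    set T : Submodule 𝒪[F] 𝒪[F] := Ideal.span {π ^ (j + 1)} with hT
    have hTS : T ≤ S := Ideal.span_singleton_le_span_singleton.2 (pow_dvd_pow π (Nat.le_succ j))
    have h := Submodule.card_quotient_mul_card_quotient S T hTS
    -- `S / T = range (t ↦ ϖ^j t mod T) ≅ 𝒪 / ϖ 𝒪`
    have hrange : S.map T.mkQ = LinearMap.range (T.mkQ ∘ₗ LinearMap.toSpanSingleton 𝒪[F] 𝒪[F] (π ^ j)) := by
      rw [LinearMap.range_comp, LinearMap.range_toSpanSingleton]
    have hker : LinearMap.ker (T.mkQ ∘ₗ LinearMap.toSpanSingleton 𝒪[F] 𝒪[F] (π ^ j)) =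
        Ideal.span {π} := by
      ext t
      rw [LinearMap.mem_ker, LinearMap.comp_apply, LinearMap.toSpanSingleton_apply,
        Submodule.mkQ_apply, Submodule.Quotient.mk_eq_zero, hT, smul_eq_mul,
        Ideal.mem_span_singleton, Ideal.mem_span_singleton, pow_succ, mul_comm t (π ^ j),
        mul_dvd_mul_iff_left (pow_ne_zero j hπ0)]
    have hcardS : Nat.card (S.map T.mkQ) = Nat.card 𝓀[F] := by
      rw [hrange, ← Nat.card_congr (LinearMap.quotKerEquivRange _).toEquiv, hker,
        natCard_quotient_span_uniformizer hϖ]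
    rw [← h, hcardS, ih, pow_succ, mul_comm]

/-- **The index of `diag(ϖ^a)`**: `[𝒪^N : ϖ^a 𝒪^N + ϖ^k 𝒪^N] = q^{∑ min(a_i, k)}`
(Macdonald (1995), Ch. II, (1.6): `|A/ϖ^k A|` for `A` of type `a`). [folklore] -/
theorem truncIndex_diagonal (k : ℕ) (a : Fin N → ℕ) :
    truncIndex (⟨ϖ, hϖ.mem⟩ : 𝒪[F]) k (Matrix.diagonal fun i => (⟨ϖ, hϖ.mem⟩ : 𝒪[F]) ^ a i) =
      Nat.card 𝓀[F] ^ (∑ i, min (a i) k) := by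
  rw [truncIndex, truncColSpan_diagonal_pow, natCard_quotient_piSpan,
    Finset.prod_congr rfl fun i _ => natCard_quotient_span_pow hϖ (min (a i) k),
    Finset.prod_pow_eq_pow_sum]

end Card

end Trunc

/-! ### The block `[[ϖ^ν, y], [0, ϖ^m]]`: its truncated lattices and the ideals `J_k` -/

section Block

variable {n : ℕ}

/-- The lattice `W_k = ⊕_{i<n} ϖ^{min(ν_i,k)} 𝒪 ⊕ ϖ^k 𝒪 ⊆ 𝒪^{n+1}`. [folklore] -/
def blockLattice (π : 𝒪[F]) (ν : Fin n → ℕ) (k : ℕ) : Submodule 𝒪[F] (Fin (n + 1) → 𝒪[F]) :=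
  piSpan (Fin.snoc (α := fun _ => 𝒪[F]) (fun i => π ^ min (ν i) k) (π ^ k))

/-- The last column `w = (y, ϖ^m)` of the block. [folklore] -/
def blockCol (π : 𝒪[F]) (y : Fin n → 𝒪[F]) (m : ℕ) : Fin (n + 1) → 𝒪[F] :=
  Fin.snoc (α := fun _ => 𝒪[F]) y (π ^ m)

/-- **The ideal `J_k = {t ∈ 𝒪 : t (y, ϖ^m) ∈ W_k}`**: the annihilator of the class of the last
column in `𝒪^{n+1} / W_k`. [folklore] -/
def blockIdeal (π : 𝒪[F]) (ν : Fin n → ℕ) (y : Fin n → 𝒪[F]) (m k : ℕ) : Ideal 𝒪[F] :=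
  (blockLattice π ν k).comap (LinearMap.toSpanSingleton 𝒪[F] (Fin (n + 1) → 𝒪[F]) (blockCol π y m))

/-- Membership in `J_k`. [folklore] -/
theorem mem_blockIdeal_iff {π : 𝒪[F]} {ν : Fin n → ℕ} {y : Fin n → 𝒪[F]} {m k : ℕ} {t : 𝒪[F]} :
    t ∈ blockIdeal π ν y m k ↔
      (∀ i, π ^ min (ν i) k ∣ t * y i) ∧ π ^ k ∣ t * π ^ m := by
  rw [blockIdeal, Submodule.mem_comap, LinearMap.toSpanSingleton_apply, blockLattice, mem_piSpan_iff,
    Fin.forall_fin_succ']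
  simp only [blockCol, Pi.smul_apply, Fin.snoc_castSucc, Fin.snoc_last, smul_eq_mul]

/-- The block matrix acts by `Y z = D z + z_n w` with `D = diag(ϖ^ν, 0)`. [folklore] -/
theorem blockSuccMatrix_mulVec_eq (π : 𝒪[F]) (ν : Fin n → ℕ) (y : Fin n → 𝒪[F]) (m : ℕ)
    (z : Fin (n + 1) → 𝒪[F]) :
    blockSuccMatrix (Matrix.diagonal fun i => π ^ ν i) y (π ^ m) *ᵥ z =
      Matrix.diagonal (Fin.snoc (α := fun _ => 𝒪[F]) (fun i => π ^ ν i) 0) *ᵥ z +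
        z (Fin.last n) • blockCol π y m := by
  conv_lhs => rw [← Fin.snoc_init_self z]
  rw [blockSuccMatrix_mulVec_snoc]
  funext i
  rcases Fin.eq_castSucc_or_eq_last i with ⟨i, rfl⟩ | rfl
  · simp [Matrix.mulVec_diagonal, blockCol, Fin.init]
  · simp [Matrix.mulVec_diagonal, blockCol, mul_comm]

/-- **The column span of the block**: `Y 𝒪^{n+1} = diag(ϖ^ν, 0) 𝒪^{n+1} + 𝒪 w`. [folklore] -/
theorem range_mulVecLin_blockSuccMatrix (π : 𝒪[F]) (ν : Fin n → ℕ) (y : Fin n → 𝒪[F]) (m : ℕ) :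
    LinearMap.range (blockSuccMatrix (Matrix.diagonal fun i => π ^ ν i) y (π ^ m)).mulVecLin =
      LinearMap.range (Matrix.diagonal (Fin.snoc (α := fun _ => 𝒪[F]) (fun i => π ^ ν i) 0)).mulVecLin ⊔
        Submodule.span 𝒪[F] {blockCol π y m} := by
  refine le_antisymm ?_ (sup_le ?_ ?_)
  · rintro _ ⟨z, rfl⟩
    rw [Matrix.mulVecLin_apply, blockSuccMatrix_mulVec_eq]
    exact Submodule.add_mem_sup (LinearMap.mem_range_self _ z)
      (Submodule.smul_mem _ _ (Submodule.mem_span_singleton_self _))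
  · rintro _ ⟨z, rfl⟩
    refine ⟨Fin.snoc (α := fun _ => 𝒪[F]) (Fin.init z) 0, ?_⟩
    rw [Matrix.mulVecLin_apply, Matrix.mulVecLin_apply, blockSuccMatrix_mulVec_eq, Fin.snoc_last,
      zero_smul, add_zero]
    funext i
    rcases Fin.eq_castSucc_or_eq_last i with ⟨i, rfl⟩ | rfl
    · simp [Matrix.mulVec_diagonal, Fin.init]
    · simp [Matrix.mulVec_diagonal]
  · rw [Submodule.span_singleton_le_iff_mem]
    refine ⟨Fin.snoc (α := fun _ => 𝒪[F]) 0 1, ?_⟩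
    rw [Matrix.mulVecLin_apply, blockSuccMatrix_mulVec_snoc, Matrix.mulVec_zero, zero_add, one_smul,
      mul_one]
    rfl

/-- **The truncated lattices of the block**: `Y 𝒪^{n+1} + ϖ^k 𝒪^{n+1} = W_k + 𝒪 w`. [folklore] -/
theorem truncColSpan_blockSuccMatrix (π : 𝒪[F]) (ν : Fin n → ℕ) (y : Fin n → 𝒪[F]) (m k : ℕ) :
    truncColSpan π k (blockSuccMatrix (Matrix.diagonal fun i => π ^ ν i) y (π ^ m)) =
      blockLattice π ν k ⊔ Submodule.span 𝒪[F] {blockCol π y m} := by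
  rw [truncColSpan, range_mulVecLin_blockSuccMatrix, sup_right_comm]
  congr 1
  refine truncColSpan_diagonal_of_sup_eq π k fun i => ?_
  rcases Fin.eq_castSucc_or_eq_last i with ⟨i, rfl⟩ | rfl
  · rw [Fin.snoc_castSucc, Fin.snoc_castSucc, span_pow_sup_span_pow]
  · rw [Fin.snoc_last, Fin.snoc_last, Ideal.span_singleton_zero, bot_sup_eq]

/-- `#(𝒪^{n+1} / W_k) = q^{∑ min(ν_i, k) + k}`. [folklore] -/
theorem natCard_quotient_blockLattice {ϖ : F} (hϖ : IsUniformizingElement ϖ) (ν : Fin n → ℕ) (k : ℕ) :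
    Nat.card ((Fin (n + 1) → 𝒪[F]) ⧸ blockLattice (⟨ϖ, hϖ.mem⟩ : 𝒪[F]) ν k) =
      Nat.card 𝓀[F] ^ (∑ i, min (ν i) k + k) := by
  rw [blockLattice, natCard_quotient_piSpan, Fin.prod_univ_castSucc, pow_add,
    ← Finset.prod_pow_eq_pow_sum]
  simp only [Fin.snoc_castSucc, Fin.snoc_last]
  rw [natCard_quotient_span_pow hϖ]
  congr 1
  exact Finset.prod_congr rfl fun i _ => natCard_quotient_span_pow hϖ _

/-- **The index formula for the block** (second and third isomorphism theorems):
`[𝒪^{n+1} : Y 𝒪^{n+1} + ϖ^k 𝒪^{n+1}] · #(𝒪 / J_k) = #(𝒪^{n+1} / W_k) = q^{∑ min(ν_i,k) + k}`,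
since `(W_k + 𝒪 w) / W_k ≅ 𝒪 / J_k`. [folklore] -/
theorem truncIndex_block_mul {ϖ : F} (hϖ : IsUniformizingElement ϖ) (ν : Fin n → ℕ)
    (y : Fin n → 𝒪[F]) (m k : ℕ) :
    truncIndex (⟨ϖ, hϖ.mem⟩ : 𝒪[F]) k
        (blockSuccMatrix (Matrix.diagonal fun i => (⟨ϖ, hϖ.mem⟩ : 𝒪[F]) ^ ν i) y
          ((⟨ϖ, hϖ.mem⟩ : 𝒪[F]) ^ m)) *
      Nat.card (𝒪[F] ⧸ blockIdeal (⟨ϖ, hϖ.mem⟩ : 𝒪[F]) ν y m k) =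
      Nat.card 𝓀[F] ^ (∑ i, min (ν i) k + k) := by
  set π : 𝒪[F] := ⟨ϖ, hϖ.mem⟩ with hπ
  set W := blockLattice π ν k with hW
  set w := blockCol π y m with hw
  rw [truncIndex, truncColSpan_blockSuccMatrix, ← natCard_quotient_blockLattice hϖ ν k]
  -- third isomorphism theorem
  have h3 := Submodule.card_quotient_mul_card_quotient (W ⊔ Submodule.span 𝒪[F] {w}) W le_sup_left
  -- second isomorphism theorem: `(W + 𝒪 w) / W ≅ 𝒪 / J`
  have hmap : (W ⊔ Submodule.span 𝒪[F] {w}).map W.mkQ =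
      LinearMap.range (W.mkQ ∘ₗ LinearMap.toSpanSingleton 𝒪[F] _ w) := by
    rw [Submodule.map_sup, Submodule.mkQ_map_self, bot_sup_eq, LinearMap.range_comp,
      LinearMap.range_toSpanSingleton]
  have hker : LinearMap.ker (W.mkQ ∘ₗ LinearMap.toSpanSingleton 𝒪[F] _ w) = blockIdeal π ν y m k := by
    rw [LinearMap.ker_comp, Submodule.ker_mkQ]
    rfl
  have hcard : Nat.card ((W ⊔ Submodule.span 𝒪[F] {w}).map W.mkQ) =
      Nat.card (𝒪[F] ⧸ blockIdeal π ν y m k) := by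
    rw [hmap, ← Nat.card_congr (LinearMap.quotKerEquivRange _).toEquiv, hker]
  rw [← h3, hcard, mul_comm]

section NoDVR

variable {ϖ : F} (hϖ : IsUniformizingElement ϖ)
include hϖ

/-- An integral `g ∈ K ϖ^a K` has truncated indices `q^{∑ min(a_i, k)}`: the value of
`|A / ϖ^k A|` on the `𝒪`-module `A = 𝒪^N / g 𝒪^N ≅ ⊕ 𝒪 / ϖ^{a_i}` of type `a`
(Macdonald (1995), Ch. II, (1.4)–(1.6)). [folklore] -/
theorem truncIndex_eq_of_mem_doubleCoset {N : ℕ} {G : Matrix (Fin N) (Fin N) 𝒪[F]} {a : Fin N → ℕ}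
    (h : ∃ k₁ ∈ glInt N F, ∃ k₂ ∈ glInt N F,
      ((k₁ : GL (Fin N) F) : Matrix (Fin N) (Fin N) F) * G.map (𝒪[F]).subtype * (k₂ : GL (Fin N) F) =
        (piPowGL hϖ.ne_zero a : GL (Fin N) F)) (k : ℕ) :
    truncIndex (⟨ϖ, hϖ.mem⟩ : 𝒪[F]) k G = Nat.card 𝓀[F] ^ (∑ i, min (a i) k) := by
  obtain ⟨_, ⟨u₁, rfl⟩, _, ⟨u₂, rfl⟩, h⟩ := h
  have hG : (u₁ : Matrix (Fin N) (Fin N) 𝒪[F]) * G * (u₂ : Matrix (Fin N) (Fin N) 𝒪[F]) =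
      Matrix.diagonal fun i => (⟨ϖ, hϖ.mem⟩ : 𝒪[F]) ^ a i := by
    apply Matrix.map_injective (f := (𝒪[F]).subtype) Subtype.val_injective
    change ((u₁ : Matrix (Fin N) (Fin N) 𝒪[F]) * G * (u₂ : Matrix (Fin N) (Fin N) 𝒪[F])).map _ =
      (Matrix.diagonal fun i => (⟨ϖ, hϖ.mem⟩ : 𝒪[F]) ^ a i).map _
    rw [Matrix.map_mul, Matrix.map_mul, Matrix.diagonal_map (map_zero _)]
    have hd : (Matrix.diagonal fun i => (𝒪[F]).subtype ((⟨ϖ, hϖ.mem⟩ : 𝒪[F]) ^ a i)) =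
        ((piPowGL hϖ.ne_zero a : GL (Fin N) F) : Matrix (Fin N) (Fin N) F) := by
      rw [coe_piPowGL]
      rfl
    rw [hd, ← h]
    rfl
  rw [← truncIndex_units_mul_mul_units _ k G u₁ u₂, hG, truncIndex_diagonal hϖ]

/-- Cancelling powers of `ϖ`: `ϖ^a ∣ ϖ^b x` implies `ϖ^{a - min(a,b)} ∣ x`. [folklore] -/
theorem IsUniformizingElement.pow_sub_min_dvd {a b : ℕ} {x : 𝒪[F]}
    (h : (⟨ϖ, hϖ.mem⟩ : 𝒪[F]) ^ a ∣ (⟨ϖ, hϖ.mem⟩ : 𝒪[F]) ^ b * x) :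
    (⟨ϖ, hϖ.mem⟩ : 𝒪[F]) ^ (a - min a b) ∣ x := by
  set π : 𝒪[F] := ⟨ϖ, hϖ.mem⟩
  rcases le_total a b with hab | hab
  · rw [min_eq_left hab, Nat.sub_self, pow_zero]; exact one_dvd _
  · rw [min_eq_right hab]
    have : π ^ a = π ^ b * π ^ (a - b) := by rw [← pow_add, Nat.add_sub_cancel' hab]
    rw [this] at h
    exact (mul_dvd_mul_iff_left (pow_ne_zero b hϖ.coe_ne_zero)).1 h

end NoDVR

/-- `q = #𝓀 > 1`. [folklore] -/
theorem one_lt_natCard_residueField [Finite 𝓀[F]] : 1 < Nat.card 𝓀[F] := Finite.one_lt_card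

/-! ### `J_k = ϖ^{D_k} 𝒪` and the behaviour of `D_k` -/

variable [IsDiscreteValuationRing 𝒪[F]] {ϖ : F} (hϖ : IsUniformizingElement ϖ)
include hϖ

/-- `ϖ` is irreducible in `𝒪`. [folklore] -/
theorem IsUniformizingElement.irreducible_coe : Irreducible (⟨ϖ, hϖ.mem⟩ : 𝒪[F]) :=
  (IsDiscreteValuationRing.irreducible_iff_uniformizer _).mpr hϖ.span_eq

omit [IsDiscreteValuationRing 𝒪[F]] in
/-- `ϖ^k ∈ J_k`. [folklore] -/
theorem pow_mem_blockIdeal (ν : Fin n → ℕ) (y : Fin n → 𝒪[F]) (m k : ℕ) :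
    (⟨ϖ, hϖ.mem⟩ : 𝒪[F]) ^ k ∈ blockIdeal (⟨ϖ, hϖ.mem⟩ : 𝒪[F]) ν y m k := by
  rw [mem_blockIdeal_iff]
  exact ⟨fun i => Dvd.dvd.mul_right (pow_dvd_pow _ (min_le_right _ _)) _, Dvd.intro _ rfl⟩

omit [IsDiscreteValuationRing 𝒪[F]] in
/-- `J_k ≠ 0`. [folklore] -/
theorem blockIdeal_ne_bot (ν : Fin n → ℕ) (y : Fin n → 𝒪[F]) (m k : ℕ) :
    blockIdeal (⟨ϖ, hϖ.mem⟩ : 𝒪[F]) ν y m k ≠ ⊥ := fun h => by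
  have := pow_mem_blockIdeal hϖ ν y m k
  rw [h, Ideal.mem_bot] at this
  exact pow_ne_zero _ hϖ.coe_ne_zero this

/-- **The exponent `D_k`** with `J_k = ϖ^{D_k} 𝒪` (every non-zero ideal of the discrete valuation
ring `𝒪` is a power of `ϖ 𝒪`). [folklore] -/
def blockExp (ν : Fin n → ℕ) (y : Fin n → 𝒪[F]) (m k : ℕ) : ℕ :=
  (IsDiscreteValuationRing.ideal_eq_span_pow_irreducible (blockIdeal_ne_bot hϖ ν y m k)
    hϖ.irreducible_coe).choose

/-- `J_k = ϖ^{D_k} 𝒪`. [folklore] -/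
theorem blockIdeal_eq_span (ν : Fin n → ℕ) (y : Fin n → 𝒪[F]) (m k : ℕ) :
    blockIdeal (⟨ϖ, hϖ.mem⟩ : 𝒪[F]) ν y m k =
      Ideal.span {(⟨ϖ, hϖ.mem⟩ : 𝒪[F]) ^ blockExp hϖ ν y m k} :=
  (IsDiscreteValuationRing.ideal_eq_span_pow_irreducible (blockIdeal_ne_bot hϖ ν y m k)
    hϖ.irreducible_coe).choose_spec

/-- Divisibility of powers of `ϖ` is the order on exponents. [folklore] -/
theorem IsUniformizingElement.coe_pow_dvd_pow_iff {a b : ℕ} :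
    (⟨ϖ, hϖ.mem⟩ : 𝒪[F]) ^ a ∣ (⟨ϖ, hϖ.mem⟩ : 𝒪[F]) ^ b ↔ a ≤ b :=
  pow_dvd_pow_iff hϖ.coe_ne_zero hϖ.irreducible_coe.not_isUnit

/-- `ϖ^a ∈ J_k ↔ D_k ≤ a`. [folklore] -/
theorem pow_mem_blockIdeal_iff (ν : Fin n → ℕ) (y : Fin n → 𝒪[F]) (m k a : ℕ) :
    (⟨ϖ, hϖ.mem⟩ : 𝒪[F]) ^ a ∈ blockIdeal (⟨ϖ, hϖ.mem⟩ : 𝒪[F]) ν y m k ↔ blockExp hϖ ν y m k ≤ a := by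
  rw [blockIdeal_eq_span, Ideal.mem_span_singleton, hϖ.coe_pow_dvd_pow_iff]

/-- `D_k ≤ k`. [folklore] -/
theorem blockExp_le (ν : Fin n → ℕ) (y : Fin n → 𝒪[F]) (m k : ℕ) : blockExp hϖ ν y m k ≤ k :=
  (pow_mem_blockIdeal_iff hϖ ν y m k k).1 (pow_mem_blockIdeal hϖ ν y m k)

/-- `#(𝒪 / J_k) = q^{D_k}`. [folklore] -/
theorem natCard_quotient_blockIdeal (ν : Fin n → ℕ) (y : Fin n → 𝒪[F]) (m k : ℕ) :
    Nat.card (𝒪[F] ⧸ blockIdeal (⟨ϖ, hϖ.mem⟩ : 𝒪[F]) ν y m k) = Nat.card 𝓀[F] ^ blockExp hϖ ν y m k := by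
  rw [blockIdeal_eq_span hϖ, natCard_quotient_span_pow hϖ]

/-- `D_0 = 0` (`J_0 = 𝒪`). [folklore] -/
theorem blockExp_zero (ν : Fin n → ℕ) (y : Fin n → 𝒪[F]) (m : ℕ) : blockExp hϖ ν y m 0 = 0 := by
  have h := (pow_mem_blockIdeal_iff hϖ ν y m 0 0).1 (by
    rw [mem_blockIdeal_iff]
    exact ⟨fun i => by rw [Nat.min_zero, pow_zero]; exact one_dvd _, by rw [pow_zero]; exact one_dvd _⟩)
  omega

/-- `D_k ≤ D_{k+1}` (`J_{k+1} ⊆ J_k`). [folklore] -/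
theorem blockExp_le_succ (ν : Fin n → ℕ) (y : Fin n → 𝒪[F]) (m k : ℕ) :
    blockExp hϖ ν y m k ≤ blockExp hϖ ν y m (k + 1) := by
  rw [← pow_mem_blockIdeal_iff hϖ ν y m k]
  have h := (pow_mem_blockIdeal_iff hϖ ν y m (k + 1) _).2 le_rfl
  rw [mem_blockIdeal_iff] at h ⊢
  refine ⟨fun i => (pow_dvd_pow _ ?_).trans (h.1 i), (pow_dvd_pow _ (Nat.le_succ k)).trans h.2⟩
  exact min_le_min_left _ (Nat.le_succ k)

/-- `D_{k+1} ≤ D_k + 1` (`ϖ J_k ⊆ J_{k+1}`). [folklore] -/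
theorem blockExp_succ_le (ν : Fin n → ℕ) (y : Fin n → 𝒪[F]) (m k : ℕ) :
    blockExp hϖ ν y m (k + 1) ≤ blockExp hϖ ν y m k + 1 := by
  rw [← pow_mem_blockIdeal_iff hϖ ν y m (k + 1)]
  have h := (pow_mem_blockIdeal_iff hϖ ν y m k _).2 le_rfl
  rw [mem_blockIdeal_iff] at h ⊢
  set π : 𝒪[F] := ⟨ϖ, hϖ.mem⟩
  set D := blockExp hϖ ν y m k
  refine ⟨fun i => ?_, ?_⟩
  · have h1 : π ^ min (ν i) (k + 1) ∣ π ^ min (ν i) k * π :=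
      (pow_dvd_pow π (by omega : min (ν i) (k + 1) ≤ min (ν i) k + 1)).trans (by rw [pow_succ])
    refine h1.trans ?_
    rw [pow_succ, mul_assoc, mul_comm π, ← mul_assoc]
    exact mul_dvd_mul_right (h.1 i) π
  · rw [pow_succ, pow_succ, mul_assoc, mul_comm π (π ^ m), ← mul_assoc]
    exact mul_dvd_mul_right h.2 π

/-- **The constraint on the extension class**: `ϖ^{ν_i - min(ν_i, D_{ν_i})} ∣ y_i`
(from `ϖ^{D_{ν_i}} ∈ J_{ν_i}`, coordinate `i`). [folklore] -/
theorem pow_sub_min_blockExp_dvd (ν : Fin n → ℕ) (y : Fin n → 𝒪[F]) (m : ℕ) (i : Fin n) :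
    (⟨ϖ, hϖ.mem⟩ : 𝒪[F]) ^ (ν i - min (ν i) (blockExp hϖ ν y m (ν i))) ∣ y i := by
  have h := (pow_mem_blockIdeal_iff hϖ ν y m (ν i) _).2 le_rfl
  rw [mem_blockIdeal_iff] at h
  have hi := h.1 i
  rw [min_self] at hi
  exact hϖ.pow_sub_min_dvd hi

/-! ### The type equations -/

variable [Finite 𝓀[F]]

/-- **The type equations of a block.** If `[[ϖ^ν, y], [0, ϖ^m]] ∈ K ϖ^Λ K` in `GL_{n+1}(F)` then for
every `k`
`∑_i min(Λ_i, k) + D_k = ∑_i min(ν_i, k) + k`,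
i.e. `|A/ϖ^k A| · |𝒪/J_k| = |A'/ϖ^k A'| · |𝒪/ϖ^k|` for `A` of type `Λ` with submodule `A'` of type
`ν` and cyclic quotient `𝒪/ϖ^m` (Macdonald (1995), Ch. II, §4, (4.2)–(4.3)). [folklore] -/
theorem sum_min_add_blockExp_eq {ν : Fin n → ℕ} {y : Fin n → 𝒪[F]} {m : ℕ} {Λ : Fin (n + 1) → ℕ}
    (h : ∃ k₁ ∈ glInt (n + 1) F, ∃ k₂ ∈ glInt (n + 1) F,
      k₁ * blockSuccGL (piPowGL hϖ.ne_zero ν) (fun i => (y i : F))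
          (Units.mk0 ϖ hϖ.ne_zero ^ (m : ℤ)) * k₂ = piPowGL hϖ.ne_zero Λ) (k : ℕ) :
    (∑ i, min (Λ i) k) + blockExp hϖ ν y m k = (∑ i, min (ν i) k) + k := by
  set π : 𝒪[F] := ⟨ϖ, hϖ.mem⟩ with hπ
  set Y : Matrix (Fin (n + 1)) (Fin (n + 1)) 𝒪[F] :=
    blockSuccMatrix (Matrix.diagonal fun i => π ^ ν i) y (π ^ m) with hY
  -- `Y` is the integral model of the block
  have hYmap : Y.map (𝒪[F]).subtype = ((blockSuccGL (piPowGL hϖ.ne_zero ν) (fun i => (y i : F))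
      (Units.mk0 ϖ hϖ.ne_zero ^ (m : ℤ)) : GL (Fin (n + 1)) F) : Matrix (Fin (n + 1)) (Fin (n + 1)) F) := by
    rw [hY, blockSuccMatrix_map, coe_blockSuccGL, coe_piPowGL, Matrix.diagonal_map (map_zero _),
      Units.val_zpow_eq_zpow_val, Units.val_mk0, zpow_natCast]
    rfl
  have hidx : truncIndex π k Y = Nat.card 𝓀[F] ^ (∑ i, min (Λ i) k) := by
    refine truncIndex_eq_of_mem_doubleCoset hϖ ?_ k
    obtain ⟨k₁, hk₁, k₂, hk₂, h⟩ := h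
    refine ⟨k₁, hk₁, k₂, hk₂, ?_⟩
    rw [hYmap, ← Units.val_mul, ← Units.val_mul, h]
  have hprod := truncIndex_block_mul hϖ ν y m k
  rw [hidx, natCard_quotient_blockIdeal hϖ, ← pow_add] at hprod
  exact Nat.pow_right_injective (one_lt_natCard_residueField (F := F)) hprod

end Block

end Literature.NumberTheory.Automorphic
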